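import Summits.ResolutionOfSingularities.ResolutionOfSingularities.Theorems.FrobeniusClosingPatchingRelPerfectDepthPhaseCOnePiecesAdapter
import Summits.ResolutionOfSingularities.ResolutionOfSingularities.Theorems.FrobeniusClosingPatchingRelPerfectDepthPhaseCOneAssembly
import HarnessLib

/-!
# Crux `PatchingRelPerfect` (stmt-ResolutionOfSingularities-16161), chain W5.2 — F7(β) (β-AX) X3 C-I (A′): THE `hCure` FRONT-END INTERFACE —
# pieces + END off the pieces + per-piece cures on opens ⇒ the pole stage of `phaseCOne_cylReach_of_stages` at `Good := GoodEnd`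

[OURS · L1 W5.2 · RECORD R13-1/R13-2 (res-L1-w52-lead-1 g6, record keeper and (A′) hand).]  Replaces the role of NO printed item; NOT a statement of
the manuscript under review (AI-written; AI review weaker than expert review; counted 0).  Def-free.  Pure composition of the pieces bridge
`goodEnd_of_closedPieces` (p571772) with the cure adapter `hcure_of_opensCure` (…PiecesAdapter): it PINS the shape the three front-end hands deliver
per reachable cylinder state — (α) a finite family of pairwise disjoint closed pieces inside `cosupp K♭` (the connected components of
N⁺ = non-END locus ∪ Sing Sfc ∪ (Sfc ∩ B), K23′), (β) local END of `K♭` off the pieces w.r.t. one global letter list (format letters on `cyl.V`: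
res-D-pv-054; carrier/LMR points off it: res-D-pv-021 / res-D-repro-1), (γ) for each piece and each open `U ⊇` it missing the other pieces, a cure
on `U` (`X3LemmaM.ContactCure₃Pw`, res-D-repro-1 via (T-e) + F-60) — and returns exactly the conclusion of the `hCure` binder of
`ChainW52F7BetaRP.phaseCOne_cylReach_of_stages` at `Good := X3LemmaM.GoodEnd`.

* `goodEnd_residual_of_pieces` — the per-state statement;
* `phaseCOne_cylReach_of_frontEnd` — (A) with `Good := GoodEnd`, `hLMG := LocallyMonomialGame` BY NAME, and the pole stage supplied per state by
  the three front-end inputs.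

## References
* U. Görtz, T. Wedhorn, *Algebraic Geometry I* (2nd ed. 2020), Prop. 13.91. [GortzWedhorn2020]
* J. Kollár, *Lectures on Resolution of Singularities* (2007), (3.111) Step 3. [Kollar2007]
-/

-- `Summit.<Summit>.<Sub>.Theorems` with `Sub = Summit` (single-conjunct summit, D-0017)
set_option linter.dupNamespace false

noncomputable section

namespace Summit.ResolutionOfSingularities.ResolutionOfSingularities.Theorems.X3LemmaM

open CategoryTheory AlgebraicGeometry TopologicalSpace IsLocalRing
open Literature.AlgebraicGeometry.Resolution
open Scheme.IdealSheafData
open Summit.ResolutionOfSingularities.ResolutionOfSingularities.Theorems.DepthMultiHost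
open Summit.ResolutionOfSingularities.ResolutionOfSingularities.Theorems.ChainW52F7BetaRP

universe u

/-- [OURS · L1 W5.2 · X3 C-I (A′)] **THE `hCure` FRONT-END, per state.**  `X` regular Noetherian, `K` an ideal sheaf (the residual `K♭` of a
reachable state), `𝓛₀` global letters, `P : Fin n → Closeds X` pairwise disjoint closed pieces inside `cosupp K` off which `K` is locally END,
and for every piece and every open `U ⊇ P i` missing the other pieces a cure on `U` (regular centres over `P i`, regular top, END of the total
transform over `P i`): then one blow-up sequence of `X` with regular centres over `cosupp K`, regular Noetherian top, and `GoodEnd (K·𝒪)`.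
[cite: GortzWedhorn2020, Prop. 13.91] -/
theorem goodEnd_of_piecesOnOpens {X : Scheme.{u}} [IsNoetherian X] (hX : Scheme.IsRegular X) (K : X.IdealSheafData)
    (𝓛₀ : List X.IdealSheafData) {n : ℕ} (P : Fin n → Closeds X)
    (hdisj : ∀ i k, i ≠ k → Disjoint (P i : Set X) (P k)) (hPK : ∀ i, (P i : Set X) ⊆ K.support)
    (hend : ∀ x ∈ (K.support : Set X), (∀ i, x ∉ (P i : Set X)) → IsEndNear K 𝓛₀ x)
    (hcure : ∀ i, ∀ U : X.Opens, (P i : Set X) ⊆ (U : Set X) → (∀ k, k ≠ i → Disjoint (U : Set X) (P k)) →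
      ∃ s : CentreSeq (U : Scheme.{u}), s.AllRegular ∧ s.CentresOver (U.ι.base ⁻¹' (P i : Set X)) ∧ Scheme.IsRegular s.top ∧
        ∃ 𝓛' : List s.top.IdealSheafData, ∀ x' ∈ (((K.comap U.ι).comap s.comp).support : Set s.top),
          s.comp.base x' ∈ U.ι.base ⁻¹' (P i : Set X) → IsEndNear ((K.comap U.ι).comap s.comp) 𝓛' x') :
    ∃ c : CentreSeq X, c.AllRegular ∧ c.CentresOver (K.support : Set X) ∧ Scheme.IsRegular c.top ∧
      ∃ _ : IsNoetherian c.top, GoodEnd (K.comap c.comp) :=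
  goodEnd_of_closedPieces hX K 𝓛₀ P hdisj hPK hend fun i Y _ g _ hPi hk => hcure_of_opensCure K P i (hcure i) Y g hPi hk

/-- [OURS · L1 W5.2 · F7(β) (β-AX) X3 C-I] **(A) WITH THE FRONT-END PLUGGED IN**: `PhaseCOne CylReach` from `LocallyMonomialGame` (BY NAME) and, for
every reachable cylinder state format-snc on `cyl.V`, the three front-end inputs (pieces, END off the pieces, cures on opens) for its residual
`K♭`. [cite: Kollar2007, (3.111) Step 3] -/
theorem phaseCOne_cylReach_of_frontEnd (hLMG : LocallyMonomialGame.{u})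
    (hFront : ∀ {X : Scheme.{u}} [IsNoetherian X], Scheme.IsRegular X → Scheme.IsExcellent X →
      ∀ (S : MultiHostState X) (cyl : CylState S) [IsIntegral cyl.Z] [IsNoetherian cyl.Z], Scheme.IsRegular cyl.Z → S.n ≠ 0 →
      ∀ (𝓒 : List X.IdealSheafData) (𝓗 : Fin S.n → List (X.IdealSheafData × ℕ)), S.IsFormatSncOn cyl.V 𝓒 𝓗 → CylReach S cyl →
      ∃ (𝓛₀ : List X.IdealSheafData) (n : ℕ) (P : Fin n → Closeds X),
        (∀ i k, i ≠ k → Disjoint (P i : Set X) (P k)) ∧ (∀ i, (P i : Set X) ⊆ S.residual.K.support) ∧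
        (∀ x ∈ (S.residual.K.support : Set X), (∀ i, x ∉ (P i : Set X)) → IsEndNear S.residual.K 𝓛₀ x) ∧
        (∀ i, ∀ U : X.Opens, (P i : Set X) ⊆ (U : Set X) → (∀ k, k ≠ i → Disjoint (U : Set X) (P k)) →
          ∃ s : CentreSeq (U : Scheme.{u}), s.AllRegular ∧ s.CentresOver (U.ι.base ⁻¹' (P i : Set X)) ∧ Scheme.IsRegular s.top ∧
            ∃ 𝓛' : List s.top.IdealSheafData, ∀ x' ∈ (((S.residual.K.comap U.ι).comap s.comp).support : Set s.top),
              s.comp.base x' ∈ U.ι.base ⁻¹' (P i : Set X) → IsEndNear ((S.residual.K.comap U.ι).comap s.comp) 𝓛' x')) :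
    PhaseCOne CylReach.{u} :=
  phaseCOne_cylReach_of_stages GoodEnd (fun Y _ _ hY hYe K hK0 hgood => hLMG Y hY hYe K hK0 hgood)
    fun hX hXe S cyl _ _ hZreg hn 𝓒 𝓗 hfmt hreach => by
      obtain ⟨𝓛₀, n, P, hdisj, hPK, hend, hcure⟩ := hFront hX hXe S cyl hZreg hn 𝓒 𝓗 hfmt hreach
      obtain ⟨c, hcreg, hcover, hctop, hcN, hgood⟩ := goodEnd_of_piecesOnOpens hX S.residual.K 𝓛₀ P hdisj hPK hend hcure
      exact ⟨c, hcreg, hcover, hctop, hcN, hgood⟩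

end Summit.ResolutionOfSingularities.ResolutionOfSingularities.Theorems.X3LemmaM

end
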